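import Summits.QuantumFields.BalabanUV.T4Continuum.Support.SkeletonPrecompGrad
import Summits.QuantumFields.BalabanUV.T4Continuum.Support.UnitaryRootInterpolation
import Literature.Analysis.Complex.RungeUnits
import HarnessLib

/-!
# T⁴ programme, node NE3 — kinematic refinement lemma, row R1-asm, part 2b: THE ROOT DATA OF THE PRE-COMPENSATED DATUM
# (radius and COVARIANT GRADIENT of the `L²`-th roots `rootH L T` of the plaquettes of `T = precomp L U`, in terms of
# the regularity data `(b, c)` of `U`) — the two inputs of row S4d's F3 bounds for the filled configuration

NE3 formalisation swarm `b2b-balaban-t4-ne3-formalise-*`, LEAF PROVER 09 (unit `b2b-balaban-t4-ne3-formalise-leaf-09`),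
row **R1-asm** (owner's RULING NE3-R1-ASSEMBLY, journal 2026-08-20T07:54:03Z).  Row S4d's F3 files (leaf-07,
`SkeletonFillFullNorms`/`…Faces`/`…Small`, F3d pending) bound the plaquettes and flux gradients of `fullFill L T h` in
terms of the ROOT data: the radius `a₀ ≥ ‖h(z;κ,ν) − 1‖` and the covariant root gradient
`δ ≥ ‖T(z,ρ)·h(z+e_ρ;κ,ι)·T(z,ρ)⁻¹ − h(z;κ,ι)‖`.  Row S4c (leaf-01, `SkeletonPrecompGrad.precomp_level`) bounds the
PLAQUETTE data of `T = precomp L U`: radius `(8d−7)b(L^j)^{−2}` and covariant FLUX gradient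
`((2d−1)c + gradRem(d)·b²)(L^j)^{−3}`.  THIS FILE converts plaquette data of `T` into root data of `h = rootH L T`
([folklore]; 0 defs, 0 sorry):
* `val_rootH_eq_upow` — `rootH L T z κ ν = upow L^{−2} (T(∂p_{κν}(z)))` (leaf-01's root IS leaf-07's geodesic power);
* `norm_covRoot_le` — for unitary `T` with plaquettes within `a ≤ 1/4` of `1` and covariant flux gradient `≤ g` at
  `(z, ρ; κ<ι)`: `‖Ad_{T(z,ρ)} h(z+e_ρ;κ,ι) − h(z;κ,ι)‖ ≤ 12·L^{−2}·g` (`upow_units_conj`, `norm_upow_sub_upow_le_six`,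
  `exp ∘ mlog = id`, `norm_exp_sub_exp_le`);
* **`rootData_precomp`** — for a class-`j` datum `U` (unitary, `SmallField U (b/(L^j)²)`, covariant flux gradients
  `≤ c/(L^j)³`, `(d−1)b ≤ 1/32`, `(8d−7)b ≤ 1/4`): with `T := precomp L U`, every root is within
  `4·L^{−2}·(8d−7)b/(L^j)²` of `1` and every covariant root gradient is `≤ 12·L^{−2}·((2d−1)c + gradRem(d)b²)/(L^j)³` —
  exactly the `(a₀, δ)` row S4d's bounds take, `j`-uniform after the scale bookkeeping of part 2.

HONEST FRAMING.  No printed sentence is a hypothesis; `precomp`/`rootH`/`rootCoeff`/`upow`/`gradRem`/`covGrad`/`flux`/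
`SmallField`/`IsUnitaryCfg` imported BY NAME, nothing restated; no `def … : Prop` fact, no definition; no `sorry`; axioms ⊆
{propext, Classical.choice, Quot.sound}.  NE3 NOT proved; `ApproxRefine` NOT proved here; spine 0/9; the cell's conditionals
(`BetaPertH`, (B), G-an2-4) occur nowhere; finite T⁴ rung (B)+1 — NOT infinite volume, NOT a mass gap, NOT the Clay problem.
HONEST DEPENDENCY (cell page 1): continuum YM on T⁴ ⇐ BetaPertH ∧ nine spine estimates (0/9 proved); BetaPertH ⇐ (D1) ∧
(D4) ∧ CAP+tail; G-an2-4 gates asym, D1 and NE2/3/4.  PLACEMENT (human rule 2026-08-19): cell work under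
`Summits/QuantumFields/BalabanUV/`; imports tree modules only; moves nothing.
-/

set_option autoImplicit false

open scoped BigOperators Matrix Matrix.Norms.L2Operator
open NormedSpace

namespace Summit.QuantumFields.BalabanUV.T4Continuum.ApproxRefineRootData

open Literature.MathematicalPhysics.QuantumFieldTheory.Balaban1983to89
open B7Prop1Explicit B7Prop2Explicit B7Prop1Local MatrixLog UnitaryModel
open T4AveragingDeficitWall hiding Site Plane Plaq Bond
open AveragingDeficitTransport (norm_Ad_of_unitary mem_U1_of_unitary)
open SkeletonFillUnitary (rootH rootLog rootCoeff rootCoeff_nonneg rootCoeff_le_one norm_rootH_sub_one_le)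
open SkeletonPrecomp (precomp)
open SkeletonPrecompGrad (gradRem gradRem_nonneg precomp_level)
open UnitaryRootInterpolation (upow norm_upow_sub_upow_le_six upow_units_conj)

noncomputable section

variable {d : ℕ} {n : Type*} [Fintype n] [DecidableEq n]

/-! ## §1 The root is the geodesic power -/

/-- leaf-01's root `rootH L T z κ ν = expUnit (L^{−2} • log T(∂p_{κν}(z)))` IS leaf-07's geodesic power `upow L^{−2}` of the
plaquette holonomy (as a matrix). [folklore] -/
theorem val_rootH_eq_upow (L : ℕ) (T : B7Prop1Explicit.Site d → Fin d → (Matrix n n ℂ)ˣ) (z : B7Prop1Explicit.Site d)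
    (κ ν : Fin d) :
    ((rootH L T z κ ν : (Matrix n n ℂ)ˣ) : Matrix n n ℂ)
      = upow (rootCoeff L) ((hol T z (plaqWord κ ν) : (Matrix n n ℂ)ˣ) : Matrix n n ℂ) := by
  rw [rootH, val_expUnit, rootLog, upow]

/-! ## §2 The covariant gradient of the roots from the covariant gradient of the fluxes -/

/-- **COVARIANT ROOT GRADIENT ≤ 12·L^{−2}·(covariant FLUX gradient)**: for unitary `T` whose two plaquettes
`T(∂p_{κι}(z))`, `T(∂p_{κι}(z+e_ρ))` (`κ < ι`) are within `a ≤ 1/4` of `1`,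
`‖T(z,ρ)·h(z+e_ρ;κ,ι)·T(z,ρ)⁻¹ − h(z;κ,ι)‖ ≤ 12·L^{−2}·‖(∇_T F)(z,ρ;κ<ι)‖`: conjugation commutes with the geodesic power
(`upow_units_conj`), the power is `6·L^{−2}`-Lipschitz on the ball of radius `1/2` (`norm_upow_sub_upow_le_six`), and
`‖Ad_{T(z,ρ)}T(∂p′) − T(∂p)‖ = ‖e^{Ad F′} − e^{F}‖ ≤ ‖Ad F′ − F‖·e^{1/2} ≤ 2‖(∇_T F)‖`. [folklore] -/
theorem norm_covRoot_le [Nonempty n] {L : ℕ} (hL : 1 ≤ L) {T : B7Prop1Explicit.Site d → Fin d → (Matrix n n ℂ)ˣ}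
    (hT : IsUnitaryCfg T) {a : ℝ} (ha : a ≤ 1 / 4) (z : B7Prop1Explicit.Site d) (ρ : Fin d) {κ ι : Fin d} (hκι : κ < ι)
    (hP : ‖((hol T z (plaqWord κ ι) : (Matrix n n ℂ)ˣ) : Matrix n n ℂ) - 1‖ ≤ a)
    (hP' : ‖((hol T (z + e ρ) (plaqWord κ ι) : (Matrix n n ℂ)ˣ) : Matrix n n ℂ) - 1‖ ≤ a) :
    ‖((T z ρ * rootH L T (z + e ρ) κ ι * (T z ρ)⁻¹ : (Matrix n n ℂ)ˣ) : Matrix n n ℂ)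
        - ((rootH L T z κ ι : (Matrix n n ℂ)ˣ) : Matrix n n ℂ)‖
      ≤ 12 * rootCoeff L * ‖covGrad T (flux T) z ρ ⟨(κ, ι), hκι⟩‖ := by
  letI : NormedAlgebra ℚ (Matrix n n ℂ) := NormedAlgebra.restrictScalars ℚ ℂ (Matrix n n ℂ)
  have ha0 : 0 ≤ a := (norm_nonneg _).trans hP
  set P : Matrix n n ℂ := ((hol T z (plaqWord κ ι) : (Matrix n n ℂ)ˣ) : Matrix n n ℂ) with hPdef
  set P' : Matrix n n ℂ := ((hol T (z + e ρ) (plaqWord κ ι) : (Matrix n n ℂ)ˣ) : Matrix n n ℂ) with hP'def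
  set u : (Matrix n n ℂ)ˣ := T z ρ with hudef
  have hu : u ∈ unitaryUnits (Matrix n n ℂ) := hT z ρ
  have hu1 : u ∈ U1 (Matrix n n ℂ) := mem_U1_of_unitary hu
  have hP'1 : ‖P' - 1‖ < 1 := lt_of_le_of_lt (hP'.trans ha) (by norm_num)
  have hP1 : ‖P - 1‖ < 1 := lt_of_le_of_lt (hP.trans ha) (by norm_num)
  -- conjugation through the power
  have hconj : ((T z ρ * rootH L T (z + e ρ) κ ι * (T z ρ)⁻¹ : (Matrix n n ℂ)ˣ) : Matrix n n ℂ)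
      = upow (rootCoeff L) ((u : Matrix n n ℂ) * P' * ((u⁻¹ : (Matrix n n ℂ)ˣ) : Matrix n n ℂ)) := by
    rw [Units.val_mul, Units.val_mul, val_rootH_eq_upow, upow_units_conj hu1 hP'1]
  -- the conjugated plaquette is within `a` of `1`
  have hAdP' : ‖(u : Matrix n n ℂ) * P' * ((u⁻¹ : (Matrix n n ℂ)ˣ) : Matrix n n ℂ) - 1‖ ≤ a := by
    have : (u : Matrix n n ℂ) * P' * ((u⁻¹ : (Matrix n n ℂ)ˣ) : Matrix n n ℂ) - 1
        = Ad u (P' - 1) := by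
      unfold Ad; rw [mul_sub, sub_mul, mul_one, Units.mul_inv]
    rw [this, norm_Ad_of_unitary hu]; exact hP'
  -- Lipschitz of the power on the ball of radius `1/2`
  have hlip := norm_upow_sub_upow_le_six (R := (u : Matrix n n ℂ) * P' * ((u⁻¹ : (Matrix n n ℂ)ˣ) : Matrix n n ℂ))
    (R' := P) (hAdP'.trans (by linarith)) (hP.trans (by linarith)) (s := rootCoeff L)
    (by rw [abs_of_nonneg (rootCoeff_nonneg L)]; exact rootCoeff_le_one hL)
  -- the transported plaquette vs the plaquette: `e^{Ad F′} − e^{F}`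
  have hexp : ‖(u : Matrix n n ℂ) * P' * ((u⁻¹ : (Matrix n n ℂ)ˣ) : Matrix n n ℂ) - P‖
      ≤ 2 * ‖covGrad T (flux T) z ρ ⟨(κ, ι), hκι⟩‖ := by
    have eP : exp (mlog P) = P := exp_mlog hP1
    have eP' : exp (mlog P') = P' := exp_mlog hP'1
    have hcov : covGrad T (flux T) z ρ ⟨(κ, ι), hκι⟩ = Ad u (mlog P') - mlog P := rfl
    have hAd : (u : Matrix n n ℂ) * P' * ((u⁻¹ : (Matrix n n ℂ)ˣ) : Matrix n n ℂ) = exp (Ad u (mlog P')) := by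
      unfold Ad; rw [Matrix.exp_units_conj, eP']
    rw [hAd, ← eP, hcov]
    conv_lhs => rw [eP]
    rw [show exp (Ad u (mlog P')) - P = exp (Ad u (mlog P')) - exp (mlog P) by rw [eP]]
    have h1 := Literature.Analysis.Complex.norm_exp_sub_exp_le (Ad u (mlog P')) (mlog P)
    have hn1 : ‖Ad u (mlog P')‖ ≤ 1 / 2 := by
      rw [norm_Ad_of_unitary hu]; exact (norm_mlog_le_two_mul (hP'.trans (by linarith))).trans (by linarith)
    have hn2 : ‖mlog P‖ ≤ 1 / 2 := (norm_mlog_le_two_mul (hP.trans (by linarith))).trans (by linarith)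
    have hmax : Real.exp (max ‖Ad u (mlog P')‖ ‖mlog P‖) ≤ 2 := by
      have h2 : Real.exp (1 / 2) ≤ 2 := by
        have := Real.exp_one_lt_d9
        have h3 : Real.exp (1 / 2) * Real.exp (1 / 2) = Real.exp 1 := by rw [← Real.exp_add]; norm_num
        nlinarith [Real.exp_pos (1 / 2 : ℝ)]
      exact (Real.exp_le_exp.mpr (max_le hn1 hn2)).trans h2
    calc ‖exp (Ad u (mlog P')) - exp (mlog P)‖ ≤ ‖Ad u (mlog P') - mlog P‖ * Real.exp (max ‖Ad u (mlog P')‖ ‖mlog P‖) := h1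
      _ ≤ ‖Ad u (mlog P') - mlog P‖ * 2 := by gcongr
      _ = 2 * ‖Ad u (mlog P') - mlog P‖ := by ring
  rw [hconj, val_rootH_eq_upow]
  calc ‖upow (rootCoeff L) ((u : Matrix n n ℂ) * P' * ((u⁻¹ : (Matrix n n ℂ)ˣ) : Matrix n n ℂ)) - upow (rootCoeff L) P‖
      ≤ 6 * |rootCoeff L| * ‖(u : Matrix n n ℂ) * P' * ((u⁻¹ : (Matrix n n ℂ)ˣ) : Matrix n n ℂ) - P‖ := hlip
    _ ≤ 6 * |rootCoeff L| * (2 * ‖covGrad T (flux T) z ρ ⟨(κ, ι), hκι⟩‖) := by gcongr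
    _ = 12 * rootCoeff L * ‖covGrad T (flux T) z ρ ⟨(κ, ι), hκι⟩‖ := by
        rw [abs_of_nonneg (rootCoeff_nonneg L)]; ring

/-! ## §3 The root data of the pre-compensated datum of a regular coarse field -/

/-- **ROOT DATA OF `T = precomp L U`** for a class-`j` datum `U` (unitary, `SmallField U (b/(L^j)²)`, covariant flux
gradients `≤ c/(L^j)³`, `0 ≤ b`, `(d−1)b ≤ 1/32`, `(8d−7)b ≤ 1/4`): `T` is unitary, every root `rootH L T z κ ν` (`κ < ν`)
is within `L^{−2}·4(8d−7)b/(L^j)²` of `1`, and every covariant root gradient is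
`≤ 12·L^{−2}·((2d−1)c + gradRem(d)·b²)/(L^j)³` (leaf-01's `precomp_level` read through §2). [folklore] -/
theorem rootData_precomp [Nonempty n] {L : ℕ} (hL : 1 ≤ L) {U : B7Prop1Explicit.Site d → Fin d → (Matrix n n ℂ)ˣ}
    (hU : IsUnitaryCfg U) {b c : ℝ} (hb : 0 ≤ b) (j : ℕ) (hs : SmallField U (b / ((L : ℝ) ^ j) ^ 2))
    (hg : ∀ (z : B7Prop1Explicit.Site d) (μ : Fin d) (π : T4AveragingDeficitWall.Plane d),
      ‖covGrad U (flux U) z μ π‖ ≤ c / ((L : ℝ) ^ j) ^ 3)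
    (hdb : ((d : ℝ) - 1) * b ≤ 1 / 32) (hdT : (8 * (d : ℝ) - 7) * b ≤ 1 / 4) :
    IsUnitaryCfg (precomp L U) ∧
    (∀ (z : B7Prop1Explicit.Site d) (κ ν : Fin d), κ < ν →
      ‖((rootH L (precomp L U) z κ ν : (Matrix n n ℂ)ˣ) : Matrix n n ℂ) - 1‖
        ≤ rootCoeff L * (4 * ((8 * (d : ℝ) - 7) * b / ((L : ℝ) ^ j) ^ 2))) ∧
    (∀ (z : B7Prop1Explicit.Site d) (ρ κ ι : Fin d), κ < ι →
      ‖((precomp L U z ρ * rootH L (precomp L U) (z + e ρ) κ ι * (precomp L U z ρ)⁻¹ : (Matrix n n ℂ)ˣ) : Matrix n n ℂ)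
          - ((rootH L (precomp L U) z κ ι : (Matrix n n ℂ)ˣ) : Matrix n n ℂ)‖
        ≤ 12 * rootCoeff L * (((2 * (d : ℝ) - 1) * c + gradRem d * b ^ 2) / ((L : ℝ) ^ j) ^ 3)) := by
  obtain ⟨hTu, hTs, hTg⟩ := precomp_level hL hU hb j hs hg hdb hdT
  rcases Nat.eq_zero_or_pos d with hd | hd
  · subst hd
    exact ⟨hTu, fun z κ => κ.elim0, fun z ρ => ρ.elim0⟩
  have hLj : (1 : ℝ) ≤ ((L : ℝ) ^ j) ^ 2 := one_le_pow₀ (one_le_pow₀ (by exact_mod_cast hL))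
  have haT : (8 * (d : ℝ) - 7) * b / ((L : ℝ) ^ j) ^ 2 ≤ 1 / 4 := by
    have h87 : 0 ≤ (8 * (d : ℝ) - 7) * b := by
      have : (1 : ℝ) ≤ d := by exact_mod_cast hd
      nlinarith
    exact (div_le_self h87 hLj).trans hdT
  refine ⟨hTu, fun z κ ν hκν => norm_rootH_sub_one_le hL _ z κ ν (hTs z κ ν hκν.ne) haT, fun z ρ κ ι hκι => ?_⟩
  have h := norm_covRoot_le hL hTu haT z ρ hκι (hTs z κ ι hκι.ne) (hTs (z + e ρ) κ ι hκι.ne)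
  exact h.trans (mul_le_mul_of_nonneg_left (hTg z ρ ⟨(κ, ι), hκι⟩) (by positivity [rootCoeff_nonneg L]))

end

end Summit.QuantumFields.BalabanUV.T4Continuum.ApproxRefineRootData
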